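import Summits.CriticalPhenomena.SAWScalingLimit.Theses.SAWRenewalTightness
import Summits.CriticalPhenomena.SAWScalingLimit.Theorems.SAWRenewalTightnessShellCrossingBoundSocketNesting
import Literature.Probability.RandomPlanarGeometry.SAWRestrictionCovariance
import Literature.Probability.RandomPlanarGeometry.CurveTortuosity
import HarnessLib

/-!
# `ShellCrossingBound`, line `pinch-on-a-circle`, stub D `stub_socketTransfer`: the socket transfer

Crux item `stmt-CriticalPhenomena-4728` (`SAWRenewalTightness.ShellCrossingBound`), registered
stub `stub_socketTransfer` (STUB D of the line skeleton `Lines/pinch-on-a-circle.lean`, with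
`SocketedEnlargement`, `ConfinementPositivity`, `BulkTwoStrandPinch`, `PinchAwayAll` unfolded):

  socketed enlargement (C) → confinement positivity (E) → interior two-strand pinch bound (F)
    → the two-strand pinch bound AWAY FROM THE MARKED POINTS in every Dobrushin domain.

For a Dobrushin domain `D = (Ω; a, b)` with an endpoint approximation and a distance `d > 0`:

1. (C at `d/2`) a Dobrushin domain `D̂ ⊇ D` with the same marked points, `D̂ ∩ (B(a, d/4) ∪
   B(b, d/4)) ⊆ Ω`, and a uniform collar `B̄(z, ε) ⊆ D̂` about every `z ∈ Ω̄` at distance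
   `≥ d/2` from both marked points;
2. (nesting, `JordanDomain.exists_forall_meshDomain_subset`) for small meshes
   `meshDomain Ω δ ⊆ meshDomain D̂ δ` — both discrete domains are single mesh components
   swallowing the lattice points of a fixed small disc `K ⊆ Ω`
   (`JordanDomain.exists_forall_mem_meshDomain_and_reachable`), and mesh reachability is
   monotone in the domain — so every `Ω_δ`-SAW is, with the same support, a `D̂_δ`-SAW
   (`exists_domainSAW_of_meshDomain_subset`), and `(a_δ, b_δ)` is an endpoint approximation of
   `D̂` as well;
3. (F in `D̂`, E for the pair `D ⊆ D̂` at socket radius `d/4`) constants `δ₁, C, s, R₁` and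
   `c, δ₂`;
4. for `δ ≤ min δ₁ δ₂ δ₃`, `R ≤ R₀ := min R₁ (ε/3) (d/4)`, `δ ≤ η < R` and a centre `y` at
   distance `≥ d` from both marked points: either no point of `Ω̄` is within `η` of `y`, and then
   NO polyline of an `Ω_δ`-SAW traverses `D(y; η, R)` even once (a non-trivial polyline lies in
   `Ω̄`, its edges being closed segments of `Ω̄`; the trivial one is constant), so the event is
   empty; or some `z ∈ Ω̄` has `dist z y ≤ η ≤ d/4`, whence `dist z a, dist z b ≥ d/2` and
   `B̄(y, 2R) ⊆ B̄(z, 3R₀) ⊆ B̄(z, ε) ⊆ D̂`: the ball is INTERIOR in `D̂`, F bounds the event in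
   `D̂` by `C (η/R)^{1+s}`, and the exact restriction covariance of the critical SAW law
   (`SAW.law_mul_law_setOf_exists_support_eq_le`: `P_Ω(E) · P_D̂(γ ⊆ Ω_δ) ≤ P_D̂(E)`) with
   `P_D̂(γ ⊆ Ω_δ) ≥ c` (E) transfers it to `Ω` with constant `C/c`.

Folklore lattice bookkeeping around the Lawler–Schramm–Werner restriction property; no new
named fact.  Mathlib anchors: `SimpleGraph.Walk.bypass`, `SimpleGraph.Walk.transfer` (through
`exists_domainSAW_of_meshDomain_subset`), `Ioc_mem_nhdsGT`, `ENNReal.le_div_iff_mul_le`,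
`ENNReal.ofReal_div_of_pos`, `Metric.closedBall_subset_closedBall'`.  H21 anchors:
`JordanDomain.exists_forall_mem_meshDomain_and_reachable` (`MeshDomainJordan.lean`),
`mem_meshDomain_of_reachable_meshVertexGraph` (`MeshDomainBigComponents.lean`),
`reachable_meshVertexGraph_mono`, `exists_domainSAW_of_meshDomain_subset`
(`SAWRenewalTightnessShellCrossingBoundSocketNesting.lean`),
`SAW.law_mul_law_setOf_exists_support_eq_le` (`SAWRestrictionCovariance.lean`),
`Curve.HasTraversals` (`CurveTortuosity.lean`).
-/

noncomputable section
open MeasureTheory Set Metric Filter Topology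
open scoped unitInterval ENNReal
open Literature.Probability.RandomPlanarGeometry Literature.Probability.LatticeModels

/-! ### Nesting of the discrete domains of nested Jordan domains -/

/-- **Nesting of the discrete domains of nested Jordan domains.** If `D ⊆ D'` are Jordan
domains then for all small meshes `δ` the discrete domain `meshDomain D δ` (union of the largest
mesh components of `D ∩ δℤ²`) is contained in `meshDomain D' δ`.  Proof: fix a closed disc
`K ⊆ D` of positive radius; for small `δ` both discrete domains contain the lattice points of `K`
and `meshDomain D δ` is a single mesh component
(`JordanDomain.exists_forall_mem_meshDomain_and_reachable`), so every vertex of `D_δ` is joined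
inside `D`, hence inside `D'`, to the lattice point nearest to the centre of `K`, which lies in
`meshDomain D' δ`; and `meshDomain D' δ` is a union of whole mesh components
(`mem_meshDomain_of_reachable_meshVertexGraph`).  A deliberate dot-notation extension of the
Literature structure `JordanDomain`, declared from the summit side. [folklore] -/
theorem _root_.Literature.Probability.RandomPlanarGeometry.JordanDomain.exists_forall_meshDomain_subset
    (D D' : JordanDomain) (h : D.carrier ⊆ D'.carrier) :
    ∃ δ₀ : ℝ, 0 < δ₀ ∧ ∀ δ : ℝ, 0 < δ → δ ≤ δ₀ →
      meshDomain D.carrier δ ⊆ meshDomain D'.carrier δ := by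
  -- the base point and the compact disc about it
  obtain ⟨z₀, hz₀⟩ := D.nonempty
  obtain ⟨ρ, hρ, hρD⟩ := Metric.isOpen_iff.1 D.isOpen z₀ hz₀
  have hKD : closedBall z₀ (ρ / 2) ⊆ D.carrier :=
    (closedBall_subset_ball (by linarith)).trans hρD
  obtain ⟨δJ, hδJ, hJ⟩ :=
    D.exists_forall_mem_meshDomain_and_reachable (isCompact_closedBall z₀ (ρ / 2)) hKD
  obtain ⟨δJ', hδJ', hJ'⟩ :=
    D'.exists_forall_mem_meshDomain_and_reachable (isCompact_closedBall z₀ (ρ / 2)) (hKD.trans h)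
  refine ⟨min (ρ / 2) (min (δJ / 2) (δJ' / 2)), by positivity, fun δ hδ hδle x hx => ?_⟩
  have hδρ : δ ≤ ρ / 2 := hδle.trans (min_le_left _ _)
  have hδ1 : δ < δJ := by
    have := hδle.trans ((min_le_right _ _).trans (min_le_left _ _)); linarith
  have hδ2 : δ < δJ' := by
    have := hδle.trans ((min_le_right _ _).trans (min_le_right _ _)); linarith
  -- the base lattice point is in both discrete domains
  set k₀ : Site 2 := nearestSite δ z₀ with hk₀_def
  have hk₀K : meshPoint δ k₀ ∈ closedBall z₀ (ρ / 2) :=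
    mem_closedBall.2 ((dist_meshPoint_nearestSite_le hδ z₀).trans hδρ)
  have hk₀D : k₀ ∈ meshDomain D.carrier δ := (hJ δ hδ hδ1).1 k₀ hk₀K
  have hk₀D' : k₀ ∈ meshDomain D'.carrier δ := (hJ' δ hδ hδ2).1 k₀ hk₀K
  -- every vertex of `D_δ` is joined to it inside `D`, hence inside `D'`
  obtain ⟨hk₀v, hxv, hreach⟩ := (hJ δ hδ hδ1).2 k₀ hk₀D x hx
  exact mem_meshDomain_of_reachable_meshVertexGraph hk₀D' _ _
    (Summit.CriticalPhenomena.SAWScalingLimit.Theorems.reachable_meshVertexGraph_mono h hreach)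

namespace Summit.CriticalPhenomena.SAWScalingLimit.Theorems

/-! ### Polylines of walks of `Ω_δ` stay in `Ω̄` -/

/-- The trace of the polyline of a trivial walk is the embedded base vertex. (Re-proof of
`SimpleGraph.Walk.range_toCurve_nil` of `Percolation/CLE6Proofs.lean`, not imported here.)
[folklore] -/
theorem range_toCurve_nil_eq {V : Type*} {G : SimpleGraph V} (emb : V → ℂ) (u : V) :
    Set.range ((SimpleGraph.Walk.nil : G.Walk u u).toCurve emb) = {emb u} := by
  simp [SimpleGraph.Walk.toCurve, polyline]

/-- The trace of the polyline of `cons h p` is the first segment followed by the trace of the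
polyline of `p`. (Re-proof of `SimpleGraph.Walk.range_toCurve_cons` of
`Percolation/CLE6Proofs.lean`.) [folklore] -/
theorem range_toCurve_cons_eq {V : Type*} {G : SimpleGraph V} (emb : V → ℂ) {u v w : V}
    (h : G.Adj u v) (p : G.Walk v w) :
    Set.range ((SimpleGraph.Walk.cons h p).toCurve emb) =
      segment ℝ (emb u) (emb v) ∪ Set.range (p.toCurve emb) := by
  cases p <;> simp [SimpleGraph.Walk.toCurve, polyline, Path.trans_range, Path.range_segment]

/-- **The trace of a polyline is controlled by the edges**: if `S` contains the embedded base
vertex and the segment `[emb x, emb y]` of every edge `x ∼ y` of the graph, the trace of the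
polyline of every walk lies in `S`. [folklore] -/
theorem range_toCurve_subset_of_adj {V : Type*} {G : SimpleGraph V} {S : Set ℂ} {emb : V → ℂ}
    (hS : ∀ ⦃x y : V⦄, G.Adj x y → segment ℝ (emb x) (emb y) ⊆ S) :
    ∀ {u v : V} (p : G.Walk u v), emb u ∈ S → Set.range (p.toCurve emb) ⊆ S
  | _, _, .nil, hu => by
    rw [range_toCurve_nil_eq]
    exact Set.singleton_subset_iff.2 hu
  | _, _, .cons h p, _ => by
    rw [range_toCurve_cons_eq]
    exact Set.union_subset (hS h)
      (range_toCurve_subset_of_adj hS p (hS h (right_mem_segment ℝ _ _)))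

/-- **No traversal far from the domain.** If the polyline of a walk of the discrete domain
`Ω_δ` makes `k ≥ 1` separate traversals of a genuine shell `D(y; η, R)` (`η < R`), some point
of `Ω̄` is within `η` of the centre `y`: a non-trivial walk has its polyline inside `Ω̄` (every
edge of `Ω_δ` is a closed segment of `Ω̄`, `meshGraph_adj_iff`), and one endpoint of a traversal
is within `η` of `y`; the polyline of the trivial walk is constant and traverses no genuine
shell. [folklore] -/
theorem exists_mem_closure_of_hasTraversals {Ω : Set ℂ} {δ : ℝ} {u v : Site 2}
    (p : (discreteDomainGraph Ω δ).Walk u v) {k : ℕ} {y : ℂ} {η R : ℝ} (hk : k ≠ 0)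
    (hηR : η < R) (h : (⟨p.toCurve (meshPoint δ)⟩ : Curve ℂ).HasTraversals k y η R) :
    ∃ z ∈ closure Ω, dist z y ≤ η := by
  obtain ⟨s, t, hst, -⟩ := h
  obtain ⟨i⟩ : Nonempty (Fin k) := Fin.pos_iff_nonempty.1 (Nat.pos_of_ne_zero hk)
  cases p with
  | nil =>
    have hc : ∀ τ : I, (⟨(SimpleGraph.Walk.nil : (discreteDomainGraph Ω δ).Walk u u).toCurve
        (meshPoint δ)⟩ : Curve ℂ) τ = meshPoint δ u := by
      intro τ
      have hτ := Set.mem_range_self (f := (SimpleGraph.Walk.nil :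
        (discreteDomainGraph Ω δ).Walk u u).toCurve (meshPoint δ)) τ
      rw [range_toCurve_nil_eq] at hτ
      exact hτ
    rcases (hst i).2 with ⟨h1, h2⟩ | ⟨h1, h2⟩ <;> rw [hc] at h1 h2 <;> linarith
  | cons hadj q =>
    have hS : ∀ ⦃x x' : Site 2⦄, (discreteDomainGraph Ω δ).Adj x x' →
        segment ℝ (meshPoint δ x) (meshPoint δ x') ⊆ closure Ω :=
      fun x x' hxx' => (meshGraph_adj_iff.1 (discreteDomainGraph_adj_iff.1 hxx').1).2
    have hr : ∀ τ : I, (⟨(SimpleGraph.Walk.cons hadj q).toCurve (meshPoint δ)⟩ : Curve ℂ) τ ∈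
        closure Ω := fun τ =>
      range_toCurve_subset_of_adj hS _ (hS hadj (left_mem_segment ℝ _ _)) (Set.mem_range_self τ)
    rcases (hst i).2 with ⟨h1, -⟩ | ⟨-, h2⟩
    · exact ⟨_, hr _, h1⟩
    · exact ⟨_, hr _, h2⟩

/-! ### The ENNReal division step -/

/-- The division step of the transfer: `p · c ≤ C q` with `c > 0` gives `p ≤ (C / c) q`
(in `ℝ≥0∞`, through `ENNReal.ofReal`). [folklore] -/
theorem le_ofReal_div_mul_of_mul_ofReal_le {p : ℝ≥0∞} {c C q : ℝ} (hc : 0 < c)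
    (h : p * ENNReal.ofReal c ≤ ENNReal.ofReal (C * q)) :
    p ≤ ENNReal.ofReal (C / c * q) := by
  have hc' : ENNReal.ofReal c ≠ 0 := (ENNReal.ofReal_pos.2 hc).ne'
  have h1 : p ≤ ENNReal.ofReal (C * q) / ENNReal.ofReal c := by
    rw [ENNReal.le_div_iff_mul_le (Or.inl hc') (Or.inl ENNReal.ofReal_ne_top)]
    exact h
  have h2 : C / c * q = C * q / c := by ring
  rw [h2, ENNReal.ofReal_div_of_pos hc]
  exact h1

/-! ### The registered stub -/

/-- **STUB D `stub_socketTransfer` (the socket transfer).** Socketed enlargement (C),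
confinement positivity (E) and the interior two-strand pinch bound (F) imply the two-strand
pinch bound away from the marked points in every Dobrushin domain with an endpoint
approximation (`PinchAwayAll`), with constant `C/c`, the same exponent `1 + s`, radius bound
`min R₁ (ε/3) (d/4)` and mesh bound `min δ₁ δ₂ δ₃`.  See the module docstring for the proof
(enlarge at `d/2`; nest the discrete domains; apply F inside the enlargement at interior balls
and divide by the confinement constant of E through the exact restriction covariance of the
critical SAW law; balls far from `Ω̄` carry an empty event). [folklore] -/
theorem stub_socketTransfer :
    (∀ (D : DobrushinDomain) (d : ℝ), 0 < d →
      ∃ (D' : DobrushinDomain) (ε : ℝ), 0 < ε ∧ D.carrier ⊆ D'.carrier ∧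
        D'.pt 0 = D.pt 0 ∧ D'.pt 1 = D.pt 1 ∧
        D'.carrier ∩ (Metric.ball (D.pt 0) (d / 2) ∪ Metric.ball (D.pt 1) (d / 2)) ⊆ D.carrier ∧
        ∀ z ∈ closure D.carrier, d ≤ dist z (D.pt 0) → d ≤ dist z (D.pt 1) →
          Metric.closedBall z ε ⊆ D'.carrier) →
    (∀ (D D' : DobrushinDomain) (a b : ℝ → Site 2) (d : ℝ), 0 < d →
      D'.carrier ⊆ D.carrier → D'.pt 0 = D.pt 0 → D'.pt 1 = D.pt 1 →
      D.carrier ∩ (Metric.ball (D.pt 0) d ∪ Metric.ball (D.pt 1) d) ⊆ D'.carrier →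
      SAW.IsEndpointApprox D' a b →
        ∃ c δ₀ : ℝ, 0 < c ∧ 0 < δ₀ ∧ ∀ δ ∈ Set.Ioc (0 : ℝ) δ₀,
          ENNReal.ofReal c ≤ SAW.law D.carrier δ (a δ) (b δ)
            {γ | ∃ γ' : SAW.DomainSAW D'.carrier δ (a δ) (b δ),
              γ'.walk.support = γ.walk.support}) →
    (∀ (D : DobrushinDomain) (a b : ℝ → Site 2), SAW.IsEndpointApprox D a b →
      ∃ (δ₀ C s R₀ : ℝ), 0 < δ₀ ∧ 0 < s ∧ 0 < R₀ ∧
        ∀ δ ∈ Set.Ioc (0 : ℝ) δ₀, ∀ (y : ℂ) (η R : ℝ),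
          Metric.closedBall y (2 * R) ⊆ D.carrier → δ ≤ η → η < R → R ≤ R₀ →
            SAW.law D.carrier δ (a δ) (b δ)
                {γ | (⟨γ.walk.toCurve (meshPoint δ)⟩ : Curve ℂ).HasTraversals 4 y η R} ≤
              ENNReal.ofReal (C * (η / R) ^ (1 + s))) →
    ∀ (D : DobrushinDomain) (a b : ℝ → Site 2), SAW.IsEndpointApprox D a b →
      ∀ d : ℝ, 0 < d → ∃ (C s R₀ δ₁ : ℝ), 0 < s ∧ 0 < R₀ ∧ 0 < δ₁ ∧
        ∀ δ ∈ Set.Ioc (0 : ℝ) δ₁, ∀ (y : ℂ) (η R : ℝ), δ ≤ η → η < R → R ≤ R₀ →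
          d ≤ dist y (D.pt 0) → d ≤ dist y (D.pt 1) →
            SAW.law D.carrier δ (a δ) (b δ)
                {γ | (⟨γ.walk.toCurve (meshPoint δ)⟩ : Curve ℂ).HasTraversals 4 y η R} ≤
              ENNReal.ofReal (C * (η / R) ^ (1 + s)) := by
  intro hC hE hF D a b hab d hd
  classical
  -- (1) the socketed enlargement at `d/2`: sockets of radius `d/4`, room at distance `≥ d/2`
  obtain ⟨D', ε, hε, hsub, hpt0, hpt1, hsock, hroom⟩ := hC D (d / 2) (half_pos hd)
  have hsock' : D'.carrier ∩ (ball (D'.pt 0) (d / 4) ∪ ball (D'.pt 1) (d / 4)) ⊆ D.carrier := by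
    rw [hpt0, hpt1]
    rwa [show d / 2 / 2 = d / 4 by ring] at hsock
  -- (2) nesting of the discrete domains for `δ ≤ δ₃`
  obtain ⟨δ₃, hδ₃, hnest⟩ :=
    D.toJordanDomain.exists_forall_meshDomain_subset D'.toJordanDomain hsub
  have hN : ∀ δ : ℝ, 0 < δ → δ ≤ δ₃ → ∀ {u v : Site 2} (γ' : SAW.DomainSAW D.carrier δ u v),
      ∃ γ : SAW.DomainSAW D'.carrier δ u v, γ.walk.support = γ'.walk.support :=
    fun δ hδ hδ' _ _ γ' => exists_domainSAW_of_meshDomain_subset hsub (hnest δ hδ hδ') γ'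
  -- (3) `(a_δ, b_δ)` is an endpoint approximation of `D̂` as well
  have hab' : SAW.IsEndpointApprox D' a b := by
    refine ⟨?_, ?_, ?_⟩
    · filter_upwards [hab.reachable, Ioc_mem_nhdsGT hδ₃] with δ hr hδ
      obtain ⟨p⟩ := hr
      obtain ⟨γ, -⟩ := hN δ hδ.1 hδ.2 ⟨p.bypass, p.bypass_isPath⟩
      exact γ.walk.reachable
    · rw [hpt0]; exact hab.tendsto_fst
    · rw [hpt1]; exact hab.tendsto_snd
  -- (4) the interior bound in `D̂` and confinement positivity for the pair `D ⊆ D̂`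
  obtain ⟨δ₁, C, s, R₁, hδ₁, hs, hR₁, hbulk⟩ := hF D' a b hab'
  obtain ⟨c, δ₂, hc, hδ₂, hconf⟩ :=
    hE D' D a b (d / 4) (by positivity) hsub hpt0.symm hpt1.symm hsock' hab
  -- (5) the constants
  refine ⟨C / c, s, min R₁ (min (ε / 3) (d / 4)), min δ₁ (min δ₂ δ₃), hs,
    lt_min hR₁ (lt_min (by positivity) (by positivity)), lt_min hδ₁ (lt_min hδ₂ hδ₃), ?_⟩
  intro δ hδ y η R hδη hηR hRR₀ hy0 hy1
  have hδ1 : δ ∈ Set.Ioc (0 : ℝ) δ₁ := ⟨hδ.1, hδ.2.trans (min_le_left _ _)⟩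
  have hδ2 : δ ∈ Set.Ioc (0 : ℝ) δ₂ :=
    ⟨hδ.1, hδ.2.trans ((min_le_right _ _).trans (min_le_left _ _))⟩
  have hδ3 : δ ≤ δ₃ := hδ.2.trans ((min_le_right _ _).trans (min_le_right _ _))
  have hR1 : R ≤ R₁ := hRR₀.trans (min_le_left _ _)
  have hRε : R ≤ ε / 3 := hRR₀.trans ((min_le_right _ _).trans (min_le_left _ _))
  have hRd : R ≤ d / 4 := hRR₀.trans ((min_le_right _ _).trans (min_le_right _ _))
  by_cases hA : ∃ z ∈ closure D.carrier, dist z y ≤ η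
  · -- (6B) the ball `B̄(y, 2R)` is interior in `D̂`: transfer by restriction covariance
    obtain ⟨z, hz, hzy⟩ := hA
    have hball : closedBall y (2 * R) ⊆ D'.carrier := by
      refine (closedBall_subset_closedBall' ?_).trans (hroom z hz ?_ ?_)
      · rw [dist_comm] at hzy
        linarith
      · linarith [dist_triangle y z (D.pt 0), dist_comm y z]
      · linarith [dist_triangle y z (D.pt 1), dist_comm y z]
    have hcov : SAW.law D.carrier δ (a δ) (b δ)
          {γ | (⟨γ.walk.toCurve (meshPoint δ)⟩ : Curve ℂ).HasTraversals 4 y η R} *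
        SAW.law D'.carrier δ (a δ) (b δ)
          {γ | ∃ γ' : SAW.DomainSAW D.carrier δ (a δ) (b δ),
            γ'.walk.support = γ.walk.support} ≤
        SAW.law D'.carrier δ (a δ) (b δ)
          {γ | (⟨γ.walk.toCurve (meshPoint δ)⟩ : Curve ℂ).HasTraversals 4 y η R} :=
      SAW.law_mul_law_setOf_exists_support_eq_le (hN δ hδ.1 hδ3)
        {γc : Curve ℂ | γc.HasTraversals 4 y η R}
    have hbig := hbulk δ hδ1 y η R hball hδη hηR hR1
    have hpos := hconf δ hδ2
    have key : SAW.law D.carrier δ (a δ) (b δ)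
          {γ | (⟨γ.walk.toCurve (meshPoint δ)⟩ : Curve ℂ).HasTraversals 4 y η R} *
        ENNReal.ofReal c ≤ ENNReal.ofReal (C * (η / R) ^ (1 + s)) :=
      calc SAW.law D.carrier δ (a δ) (b δ)
              {γ | (⟨γ.walk.toCurve (meshPoint δ)⟩ : Curve ℂ).HasTraversals 4 y η R} *
            ENNReal.ofReal c
          ≤ SAW.law D.carrier δ (a δ) (b δ)
              {γ | (⟨γ.walk.toCurve (meshPoint δ)⟩ : Curve ℂ).HasTraversals 4 y η R} *
            SAW.law D'.carrier δ (a δ) (b δ)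
              {γ | ∃ γ' : SAW.DomainSAW D.carrier δ (a δ) (b δ),
                γ'.walk.support = γ.walk.support} := mul_le_mul' le_rfl hpos
        _ ≤ SAW.law D'.carrier δ (a δ) (b δ)
              {γ | (⟨γ.walk.toCurve (meshPoint δ)⟩ : Curve ℂ).HasTraversals 4 y η R} := hcov
        _ ≤ ENNReal.ofReal (C * (η / R) ^ (1 + s)) := hbig
    exact le_ofReal_div_mul_of_mul_ofReal_le hc key
  · -- (6A) no point of `Ω̄` within `η` of `y`: the event is empty
    have hempty : {γ : SAW.DomainSAW D.carrier δ (a δ) (b δ) |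
        (⟨γ.walk.toCurve (meshPoint δ)⟩ : Curve ℂ).HasTraversals 4 y η R} = ∅ :=
      Set.eq_empty_iff_forall_notMem.2 fun γ hγ =>
        hA (exists_mem_closure_of_hasTraversals γ.walk (by norm_num) hηR hγ)
    rw [hempty, measure_empty]
    exact bot_le

end Summit.CriticalPhenomena.SAWScalingLimit.Theorems

end
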